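import Literature.AlgebraicGeometry.Resolution.AlterationsFormalNodesSing
import Literature.AlgebraicGeometry.Resolution.AlterationsNodeLocalStructure
import Literature.AlgebraicGeometry.Resolution.AlterationsFormalCoordinates
import Literature.AlgebraicGeometry.Resolution.MvPowerSeriesNested
import Literature.AlgebraicGeometry.Resolution.AlterationsNodalFibre
import HarnessLib

/-!
# De Jong's alteration theorem: the split nodal structure with the trace of `Sing(f)` —
# assembly from the node local structure (2.23 + 3.3) and the Remark of 2.23

Topic: `Literature/AlgebraicGeometry/Resolution`. Proof file of `AlterationsFormalNodesSing.lean`,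
whose named fact `DeJong1996SplitNodalStructureSing` (de Jong 1996, 2.23 with its Remark, and
3.3, split case, at a closed point of `Sing(f)` of the curve of a pair in Situation 4.23 over an
algebraically closed field `k`) asserts an isomorphism
`e : 𝒪̂_{X,x} ≅ k⟦u, v, T₁, …, T_m⟧/(uv - ∏ Tᵢ^{νᵢ})` with `f^#(tᵢ) ↦ Tᵢ` carrying the extension of
`Fitt₁(Ω_{X/Y})_x` to the ideal `(u, v)`. The printed argument has four parts, and this file
reduces the fact to exactly the two of them that are local statements about the semi-stable
curve, the other two being proved in the tree:

1. **2.23 + 3.3** — the `𝒪̂_{Y,f x}`-algebra isomorphism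
   `𝒪̂_{X,x} ≅ 𝒪̂_{Y,f x}⟦u, v⟧/(uv - t̂₁^{n₁} ⋯ t̂_r^{n_r})`: the named fact
   `DeJong1996NodeLocalStructure` (`AlterationsNodeLocalStructure.lean`; its core, Liu 2002 Lemma
   10.3.20 = 2.23 for the local rings, is proved in `NodalDeformation.lean`).
2. **The Remark of 2.23** — "We remark that in this case (i.e. `h ∈ A'`) the trace of `Sing(f)`
   on the scheme `Spec B` is given by the ideal `(u, v) ⊂ B`" (p. 62): for the structure
   isomorphism `e₁ : 𝒪̂_{X,x} ≅ Â⟦u, v⟧/(uv - h)` over `Â = 𝒪̂_{Y,f x}`, `e₁` carries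
   `Fitt₁(Ω_{𝒪_{X,x}/𝒪_{Y,f x}}) · 𝒪̂_{X,x}` onto `(u, v)` (`Fitt₁(Ω_{B/A}) B̂` is `Fitt₁` of
   `Ω_{B/A} ⊗_B B̂`, the module of `𝔪`-adically continuous `Â`-differentials of `B̂`, an invariant
   of the topological `Â`-algebra `B̂`; for `Â⟦u, v⟧/(uv - h)` with `h ∈ Â` it is
   `(B̂ du ⊕ B̂ dv)/(v du + u dv)`, with first Fitting ideal `(u, v)`). It enters the last theorem
   of this file as an explicit hypothesis, to be discharged by that computation (it is not
   vendored as a named fact).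
3. **Cohen's structure theorem for the base** `𝒪̂_{Y,f x} ≅ k⟦T₁, …, T_m⟧`, `t̂ᵢ ↦ Tᵢ`: PROVED in
   the tree (`exists_ringEquiv_adicCompletion_stalk_mvPowerSeries`,
   `AlterationsFormalCoordinates.lean`).
4. **Rebracketing** `k⟦T⟧⟦u, v⟧/(uv - ∏ Tᵢ^{νᵢ}) ≅ k⟦u, v, T⟧/(uv - ∏ Tᵢ^{νᵢ})`: PROVED here
   (`DeJong1996.NodeDeformationRing.congr`, `DeJong1996.NodeDeformationRing.toFormalNodeRing`)
   from `MvPowerSeriesNested.nestedEquiv`.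

Results (all PROVED):

* `DeJong1996.SemiStablePair.exists_formalNodeRing_equiv_of_nodeLocalStructure` — the common
  core: from `DeJong1996NodeLocalStructure`, at a closed point `x` at which `f` is not smooth and
  for a regular system of parameters `t₁, …, t_m` of `𝒪_{Y,f x}` with `I(D)_{f x} = (t₁ ⋯ t_r)`,
  exponents `ν` vanishing beyond `r`, the structure isomorphism
  `e₁ : 𝒪̂_{X,x} ≅ Â⟦u, v⟧/(uv - h)` over `Â`, and `E : Â⟦u, v⟧/(uv - h) ≅ k⟦u, v, T⟧/(uv - ∏ Tᵢ^{νᵢ})`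
  with `E(e₁(f^#(tᵢ))) = Tᵢ`, `E(u) = u`, `E(v) = v` (the bookkeeping: `r ≥ 1` because a point
  over `Y ∖ D` has a smooth neighbourhood; `(t₁, …, t_m) = (t₁, …, t_r; t_{r+1}, …, t_m)`;
  `I(closure D) = I(D)` on every affine open; Cohen coordinates; rebracketing);
* `DeJong1996SplitNodalStructure.of_nodeLocalStructure` —
  `DeJong1996NodeLocalStructure → DeJong1996SplitNodalStructure`;
* `DeJong1996SplitNodalStructureSing.of_nodeLocalStructure_of_singTrace` —
  `DeJong1996NodeLocalStructure →` (the Remark of 2.23 for the structure isomorphisms at the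
  closed points of `Sing(f)` of a pair) `→ DeJong1996SplitNodalStructureSing`.

So `DeJong1996SplitNodalStructure` rests on the named fact `DeJong1996NodeLocalStructure` alone,
and `DeJong1996SplitNodalStructureSing` on it and on the Remark of 2.23.

## Sources

* A. J. de Jong, *Smoothness, semi-stability and alterations*, Publ. Math. IHÉS 83 (1996) 51–93:
  2.21, 2.23 with its Remark (pp. 61–62), 3.3 (p. 63), 4.23–4.24 (p. 75).
* H. Matsumura, *Commutative Ring Theory* (1986), Thm. 29.7 (Cohen), via
  `AlterationsFormalCoordinates.lean`.
* D. Eisenbud, *Commutative Algebra*, GTM 150 (1995), Cor. 20.5 and §16.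
-/

noncomputable section

open CategoryTheory CategoryTheory.Limits AlgebraicGeometry TopologicalSpace Topology
  IsLocalRing

namespace Literature.AlgebraicGeometry.Resolution

universe u

open Scheme.IdealSheafData

/-! ## Rebracketing the model ring: `Â⟦u, v⟧/(uv - h)` along `Â ≅ k⟦T⟧`, and
`k⟦T⟧⟦u, v⟧/(uv - ∏ Tᵢ^{νᵢ}) ≅ k⟦u, v, T⟧/(uv - ∏ Tᵢ^{νᵢ})` -/

/-- `nestedEquiv⁻¹ (X s) = X (inl s)`. [folklore] -/
theorem MvPowerSeriesNested.nestedEquiv_symm_X {σ τ : Type*} (R : Type*) [CommRing R] (s : σ) :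
    (MvPowerSeriesNested.nestedEquiv σ τ R).symm (MvPowerSeries.X s) = MvPowerSeries.X (Sum.inl s) :=
  (RingEquiv.symm_apply_eq _).mpr (MvPowerSeriesNested.nestedEquiv_X_inl s).symm

/-- `nestedEquiv⁻¹ (C p) = inrHom p`. [folklore] -/
theorem MvPowerSeriesNested.nestedEquiv_symm_C {σ τ : Type*} (R : Type*) [CommRing R]
    (p : MvPowerSeries τ R) :
    (MvPowerSeriesNested.nestedEquiv σ τ R).symm (MvPowerSeries.C p) =
      MvPowerSeriesNested.inrHom σ τ R p :=
  rfl

namespace DeJong1996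

namespace NodeDeformationRing

/-- Changing the coefficient ring of `A⟦u, v⟧/(uv - h)` along a ring isomorphism `ι : A ≅ A'`
(coefficientwise on power series) gives `A⟦u, v⟧/(uv - h) ≅ A'⟦u, v⟧/(uv - ι h)`. [folklore] -/
def congr {A A' : Type u} [CommRing A] [CommRing A'] (ι : A ≃+* A') (h : A) (h' : A')
    (hh : ι h = h') : NodeDeformationRing A h ≃+* NodeDeformationRing A' h' :=
  Ideal.quotientEquiv _ _ (MvPowerSeries.mapRingEquiv (σ := Fin 2) ι) (by
    rw [Ideal.map_span, Set.image_singleton]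
    refine congrArg (fun a => Ideal.span {a}) ?_
    change nodeDeformationRelation A' h' =
      MvPowerSeries.map (σ := Fin 2) ι.toRingHom (nodeDeformationRelation A h)
    rw [nodeDeformationRelation, nodeDeformationRelation, map_sub, map_mul, MvPowerSeries.map_X,
      MvPowerSeries.map_X, MvPowerSeries.map_C, RingEquiv.toRingHom_eq_coe, RingHom.coe_coe, hh])

/-- `congr` on the class of a power series. [folklore] -/
theorem congr_mk {A A' : Type u} [CommRing A] [CommRing A'] (ι : A ≃+* A') (h : A) (h' : A')
    (hh : ι h = h') (φ : MvPowerSeries (Fin 2) A) :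
    congr ι h h' hh (Ideal.Quotient.mk _ φ) =
      Ideal.Quotient.mk _ (MvPowerSeries.map (σ := Fin 2) ι.toRingHom φ) :=
  rfl

/-- `congr` fixes the classes of the variables `u`, `v`. [folklore] -/
theorem congr_mk_X {A A' : Type u} [CommRing A] [CommRing A'] (ι : A ≃+* A') (h : A) (h' : A')
    (hh : ι h = h') (s : Fin 2) :
    congr ι h h' hh (Ideal.Quotient.mk _ (MvPowerSeries.X s)) =
      Ideal.Quotient.mk _ (MvPowerSeries.X s) := by
  rw [congr_mk, MvPowerSeries.map_X]

/-- `congr` acts by `ι` on the classes of the constants. [folklore] -/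
theorem congr_mk_C {A A' : Type u} [CommRing A] [CommRing A'] (ι : A ≃+* A') (h : A) (h' : A')
    (hh : ι h = h') (a : A) :
    congr ι h h' hh (Ideal.Quotient.mk _ (MvPowerSeries.C a)) =
      Ideal.Quotient.mk _ (MvPowerSeries.C (ι a)) := by
  rw [congr_mk, MvPowerSeries.map_C, RingEquiv.toRingHom_eq_coe, RingHom.coe_coe]

/-- **Rebracketing**: `k⟦T₁, …, T_m⟧⟦u, v⟧/(uv - ∏ Tᵢ^{νᵢ}) ≅ k⟦u, v, T₁, …, T_m⟧/(uv - ∏ Tᵢ^{νᵢ})`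
(`FormalNodeRing k m ν`), the inverse of `MvPowerSeriesNested.nestedEquiv` (`u, v ↦ u, v`,
constants `T ↦ T`). [folklore] -/
def toFormalNodeRing (k : Type u) [Field k] (m : ℕ) (ν : Fin m → ℕ) :
    NodeDeformationRing (MvPowerSeries (Fin m) k) (∏ i, MvPowerSeries.X i ^ ν i) ≃+*
      FormalNodeRing k m ν :=
  Ideal.quotientEquiv _ _ (MvPowerSeriesNested.nestedEquiv (Fin 2) (Fin m) k).symm (by
    rw [Ideal.map_span, Set.image_singleton]
    refine congrArg (fun a => Ideal.span {a}) ?_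
    change formalNodeRelation k m ν =
      (MvPowerSeriesNested.nestedEquiv (Fin 2) (Fin m) k).symm
        (nodeDeformationRelation (MvPowerSeries (Fin m) k) (∏ i, MvPowerSeries.X i ^ ν i))
    rw [nodeDeformationRelation, formalNodeRelation, map_sub, map_mul,
      MvPowerSeriesNested.nestedEquiv_symm_X, MvPowerSeriesNested.nestedEquiv_symm_X,
      MvPowerSeriesNested.nestedEquiv_symm_C, map_prod]
    congr 1
    exact Finset.prod_congr rfl fun i _ => by rw [map_pow, MvPowerSeriesNested.inrHom_X])

/-- `toFormalNodeRing` fixes the classes of `u`, `v`. [folklore] -/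
theorem toFormalNodeRing_mk_X (k : Type u) [Field k] (m : ℕ) (ν : Fin m → ℕ) (s : Fin 2) :
    toFormalNodeRing k m ν (Ideal.Quotient.mk _ (MvPowerSeries.X s)) =
      Ideal.Quotient.mk _ (MvPowerSeries.X (Sum.inl s)) := by
  change Ideal.Quotient.mk _ ((MvPowerSeriesNested.nestedEquiv (Fin 2) (Fin m) k).symm
    (MvPowerSeries.X s)) = _
  rw [MvPowerSeriesNested.nestedEquiv_symm_X]

/-- `toFormalNodeRing` sends the class of the constant `Tᵢ` to the class of `Tᵢ`. [folklore] -/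
theorem toFormalNodeRing_mk_C_X (k : Type u) [Field k] (m : ℕ) (ν : Fin m → ℕ) (i : Fin m) :
    toFormalNodeRing k m ν (Ideal.Quotient.mk _ (MvPowerSeries.C (MvPowerSeries.X i))) =
      Ideal.Quotient.mk _ (MvPowerSeries.X (Sum.inr i)) := by
  change Ideal.Quotient.mk _ (MvPowerSeriesNested.inrHom (Fin 2) (Fin m) k (MvPowerSeries.X i)) = _
  rw [MvPowerSeriesNested.inrHom_X]

end NodeDeformationRing

end DeJong1996

/-! ## Bookkeeping: splitting a regular system of parameters at `r` -/

/-- A product over `{i : Fin m | i < r}` is a product over `Fin r`. [folklore] -/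
theorem prod_filter_lt_eq_prod_castLE {M : Type*} [CommMonoid M] {m r : ℕ} (hrm : r ≤ m)
    (c : Fin m → M) :
    ∏ i ∈ Finset.univ.filter (fun i : Fin m => i.val < r), c i = ∏ j : Fin r, c (Fin.castLE hrm j) := by
  classical
  have hset : Finset.univ.filter (fun i : Fin m => i.val < r) =
      Finset.univ.image (Fin.castLE hrm) := by
    ext i
    simp only [Finset.mem_filter, Finset.mem_univ, true_and, Finset.mem_image]
    constructor
    · intro hi
      exact ⟨⟨i.val, hi⟩, Fin.ext rfl⟩
    · rintro ⟨j, rfl⟩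
      exact j.isLt
  rw [hset, Finset.prod_image (fun j _ j' _ h => Fin.castLE_injective hrm h)]

/-- `{t₁, …, t_m} = {t₁, …, t_r} ∪ {t_{r+1}, …, t_m}`. [folklore] -/
theorem range_eq_range_castLE_union {α : Type*} {m r : ℕ} (hrm : r ≤ m) (t : Fin m → α) :
    Set.range t = Set.range (fun j : Fin r => t (Fin.castLE hrm j)) ∪
      Set.range (fun j : Fin (m - r) => t ⟨r + j.val, by omega⟩) := by
  ext a
  simp only [Set.mem_range, Set.mem_union]
  constructor
  · rintro ⟨i, rfl⟩
    by_cases hi : i.val < r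
    · exact Or.inl ⟨⟨i.val, hi⟩, congrArg t (Fin.ext rfl)⟩
    · refine Or.inr ⟨⟨i.val - r, by omega⟩, congrArg t (Fin.ext ?_)⟩
      show r + (i.val - r) = i.val
      omega
  · rintro (⟨j, rfl⟩ | ⟨j, rfl⟩)
    · exact ⟨_, rfl⟩
    · exact ⟨_, rfl⟩

/-! ## The assembly -/

namespace DeJong1996.SemiStablePair

variable {k : Type u} [Field k] {X Y : Scheme.{u}} {f : X ⟶ Y} {g : Y ⟶ Spec (.of k)}
  {D : Set Y} {n : ℕ} {τ : Fin n → (Y ⟶ X)}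

/-- A point at which `f` is smooth on no neighbourhood lies over `D` (`f` is smooth over
`Y ∖ D`, 4.23). [cite: DeJong1996, 4.23, p. 75] -/
theorem apply_mem_of_forall_not_smooth (hS : SemiStablePair f g D τ) {x : X}
    (hx : ∀ U : X.Opens, x ∈ U → ¬ Smooth (U.ι ≫ f)) : f x ∈ D := by
  by_contra hxD
  let V : Y.Opens := ⟨Dᶜ, hS.isStrictNormalCrossingsDivisor.isClosed.isOpen_compl⟩
  haveI : Smooth (f ∣_ V) := hS.smooth_morphismRestrict
  refine hx (f ⁻¹ᵁ V) hxD ?_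
  rw [← morphismRestrict_ι]
  infer_instance

/-- If `y ∈ D` and `I(D)_y = (∏_{i<r} tᵢ)`, then `r ≥ 1` (for `r = 0` the ideal would be the
unit ideal, while `I(D)_y ⊆ 𝔪_y` at a point of `D`). [folklore] -/
theorem one_le_of_stalkIdeal_eq (hS : SemiStablePair f g D τ) {y : Y} (hy : y ∈ D) {m r : ℕ}
    (t : Fin m → Y.presheaf.stalk y)
    (hI : stalkIdeal (vanishingIdeal ⟨D, hS.isStrictNormalCrossingsDivisor.isClosed⟩) y =
      Ideal.span {∏ i ∈ Finset.univ.filter (fun i : Fin m => i.val < r), t i}) : 1 ≤ r := by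
  by_contra hr
  have hr0 : r = 0 := by omega
  subst hr0
  have hempty : Finset.univ.filter (fun i : Fin m => i.val < 0) = ∅ := by
    ext i
    simp
  rw [hempty, Finset.prod_empty, Ideal.span_singleton_one] at hI
  have hle := (mem_support_iff_stalkIdeal_le
    (vanishingIdeal ⟨D, hS.isStrictNormalCrossingsDivisor.isClosed⟩) y).mp (by
      rw [← SetLike.mem_coe, coe_support_vanishingIdeal]
      exact hy)
  rw [hI, top_le_iff] at hle
  exact (maximalIdeal.isMaximal _).ne_top hle

/-- **The common core of the assembly.** From `DeJong1996NodeLocalStructure`: at a closed point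
`x` at which `f` is not smooth, for a regular system of parameters `t₁, …, t_m` of `𝒪_{Y,f x}`
with `I(D)_{f x} = (∏_{i<r} tᵢ)`, there are exponents `ν` on `Fin m` vanishing beyond `r`, the
structure isomorphism `e₁ : 𝒪̂_{X,x} ≅ Â⟦u, v⟧/(uv - h)` over `Â = 𝒪̂_{Y,f x}`
(`h = ∏ t̂ᵢ^{nᵢ}`), and the rebracketing `E : Â⟦u, v⟧/(uv - h) ≅ k⟦u, v, T⟧/(uv - ∏ Tᵢ^{νᵢ})`
along Cohen coordinates `Â ≅ k⟦T⟧`, `t̂ᵢ ↦ Tᵢ`, with `E(e₁(f^#(tᵢ))) = Tᵢ` and `E(u) = u`,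
`E(v) = v`. [cite: DeJong1996, 2.23 and 3.3, pp. 61–63] -/
theorem exists_formalNodeRing_equiv_of_nodeLocalStructure [IsAlgClosed k]
    (hN : DeJong1996NodeLocalStructure.{u}) (hS : SemiStablePair f g D τ) {x : X}
    (hx : IsClosed ({x} : Set X)) (hns : ∀ U : X.Opens, x ∈ U → ¬ Smooth (U.ι ≫ f))
    {m r : ℕ} (t : Fin m → Y.presheaf.stalk (f x))
    (hspan : Ideal.span (Set.range t) = maximalIdeal (Y.presheaf.stalk (f x)))
    (hdim : ringKrullDim (Y.presheaf.stalk (f x)) = m) (hrm : r ≤ m)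
    (hI : stalkIdeal (vanishingIdeal ⟨D, hS.isStrictNormalCrossingsDivisor.isClosed⟩) (f x) =
      Ideal.span {∏ i ∈ Finset.univ.filter (fun i : Fin m => i.val < r), t i}) :
    ∃ (ν : Fin m → ℕ)
      (h : AdicCompletion (maximalIdeal (Y.presheaf.stalk (f x))) (Y.presheaf.stalk (f x)))
      (e₁ : AdicCompletion (maximalIdeal (X.presheaf.stalk x)) (X.presheaf.stalk x) ≃+*
        NodeDeformationRing _ h)
      (E : NodeDeformationRing _ h ≃+* FormalNodeRing k m ν),
      (∀ i : Fin m, r ≤ i.val → ν i = 0) ∧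
      e₁.toRingHom.comp (completedStalkMap f x) = NodeDeformationRing.ofBase _ _ ∧
      (∀ i : Fin m, E (e₁ (algebraMap _ _ ((f.stalkMap x).hom (t i)))) =
        Ideal.Quotient.mk _ (MvPowerSeries.X (Sum.inr i))) ∧
      (∀ s : Fin 2, E (Ideal.Quotient.mk _ (MvPowerSeries.X s)) =
        Ideal.Quotient.mk _ (MvPowerSeries.X (Sum.inl s))) := by
  classical
  -- `f x` is a closed point of `Y`, which is of finite type over `k`; `𝒪_{Y,f x}` is regular
  haveI : IsProper g :=
    Literature.AlgebraicGeometry.Motives.IsProjectiveOver.isProper (X := Over.mk g)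
      hS.isProjectiveOver_base
  have hy : IsClosed ({f x} : Set Y) := hS.isClosed_image hx
  haveI : IsRegularLocalRing (Y.presheaf.stalk (f x)) := hS.isRegular_base (f x)
  -- `r ≥ 1`
  have hr1 : 1 ≤ r := hS.one_le_of_stalkIdeal_eq (hS.apply_mem_of_forall_not_smooth hns) t hI
  -- split the parameters: `t' = (t₁, …, t_r)`, `y = (t_{r+1}, …, t_m)`
  let t' : Fin r → Y.presheaf.stalk (f x) := fun j => t (Fin.castLE hrm j)
  let y : Fin (m - r) → Y.presheaf.stalk (f x) := fun j => t ⟨r + j.val, by omega⟩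
  have hspan' : Ideal.span (Set.range t' ∪ Set.range y) = maximalIdeal (Y.presheaf.stalk (f x)) := by
    rw [← range_eq_range_castLE_union hrm t, hspan]
  have hdim' : ringKrullDim (Y.presheaf.stalk (f x)) = ((r + (m - r) : ℕ) : WithBot ℕ∞) := by
    rw [Nat.add_sub_cancel' hrm]
    exact hdim
  -- the divisor hypothesis on the affine opens through `f x`
  have hcl : (⟨closure D, isClosed_closure⟩ : Closeds Y) =
      ⟨D, hS.isStrictNormalCrossingsDivisor.isClosed⟩ :=
    Closeds.ext hS.isStrictNormalCrossingsDivisor.isClosed.closure_eq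
  have hdiv : ∀ (U : Y.affineOpens) (hU : f x ∈ (U : Y.Opens)),
      ((vanishingIdeal ⟨closure D, isClosed_closure⟩).ideal U).map
          (Y.presheaf.germ U (f x) hU).hom = Ideal.span {∏ i, t' i} := by
    intro U hU
    rw [hcl, ← stalkIdeal_eq_map_germ _ U hU, hI, prod_filter_lt_eq_prod_castLE hrm]
  -- 2.23 + 3.3: the structure isomorphism over `Â`
  obtain ⟨mexp, e₁, he₁, -, -⟩ :=
    hN k X Y f g D n τ hS x hx hns r (m - r) t' y hr1 hdim' hspan' hdiv
  -- Cohen coordinates on `Â`: `ι (t̂ᵢ) = Tᵢ`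
  obtain ⟨ι, hι⟩ := exists_ringEquiv_adicCompletion_stalk_mvPowerSeries g hy t hspan hdim
  -- the exponents on `Fin m`
  let ν : Fin m → ℕ := fun i => if hi : i.val < r then mexp ⟨i.val, hi⟩ else 0
  have hν : ∀ i : Fin m, r ≤ i.val → ν i = 0 := fun i hi => by
    simp only [ν, dif_neg (not_lt.mpr hi)]
  have hνcast : ∀ j : Fin r, ν (Fin.castLE hrm j) = mexp j := fun j => by
    have hj : (Fin.castLE hrm j).val < r := j.isLt
    simp only [ν, dif_pos hj]
    exact congrArg mexp (Fin.ext rfl)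
  -- `ι h = ∏ Tᵢ^{νᵢ}`
  have hιh : ι (∏ j, AdicCompletion.of _ _ (t' j) ^ mexp j) = ∏ i, MvPowerSeries.X i ^ ν i := by
    rw [map_prod]
    have h1 : ∀ j : Fin r, ι (AdicCompletion.of _ _ (t' j) ^ mexp j) =
        MvPowerSeries.X (Fin.castLE hrm j) ^ ν (Fin.castLE hrm j) := fun j => by
      rw [map_pow, hνcast]
      exact congrArg (fun a => a ^ mexp j) (hι (Fin.castLE hrm j))
    rw [Finset.prod_congr rfl fun j _ => h1 j,
      ← prod_filter_lt_eq_prod_castLE hrm (fun i => MvPowerSeries.X i ^ ν i), Finset.prod_filter]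
    refine Finset.prod_congr rfl fun i _ => ?_
    split_ifs with hi
    · rfl
    · rw [hν i (not_lt.mp hi), pow_zero]
  -- the rebracketing `E = toFormalNodeRing ∘ congr ι`
  refine ⟨ν, _, e₁,
    (NodeDeformationRing.congr ι _ _ hιh).trans (NodeDeformationRing.toFormalNodeRing k m ν),
    hν, he₁, fun i => ?_, fun s => ?_⟩
  · -- `E (e₁ (f^#(tᵢ))) = Tᵢ`
    have h1 : algebraMap (X.presheaf.stalk x) _ ((f.stalkMap x).hom (t i)) =
        completedStalkMap f x (AdicCompletion.of _ _ (t i)) := (completedStalkMap_of f x (t i)).symm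
    have h2 : e₁ (completedStalkMap f x (AdicCompletion.of _ _ (t i))) =
        Ideal.Quotient.mk _ (MvPowerSeries.C (AdicCompletion.of _ _ (t i))) := by
      have := DFunLike.congr_fun he₁ (AdicCompletion.of _ _ (t i))
      rw [RingHom.comp_apply, NodeDeformationRing.ofBase_apply] at this
      exact this
    rw [h1, h2, RingEquiv.trans_apply, NodeDeformationRing.congr_mk_C]
    have h3 : ι (AdicCompletion.of _ _ (t i)) = MvPowerSeries.X i := hι i
    rw [h3, NodeDeformationRing.toFormalNodeRing_mk_C_X]
  · rw [RingEquiv.trans_apply, NodeDeformationRing.congr_mk_X,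
      NodeDeformationRing.toFormalNodeRing_mk_X]

end DeJong1996.SemiStablePair

/-- **`DeJong1996SplitNodalStructure` from `DeJong1996NodeLocalStructure`** (2.23 + 3.3 over
`Â`, followed by Cohen coordinates on `Â` and rebracketing). [cite: DeJong1996, 3.3, p. 63] -/
theorem DeJong1996SplitNodalStructure.of_nodeLocalStructure
    (hN : DeJong1996NodeLocalStructure.{u}) : DeJong1996SplitNodalStructure.{u} := by
  intro k _ _ X Y f g D n τ hS x hx hns m r t hspan hdim hrm hI
  obtain ⟨ν, h, e₁, E, hν, -, ht, -⟩ :=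
    hS.exists_formalNodeRing_equiv_of_nodeLocalStructure hN hx hns t hspan hdim hrm hI
  exact ⟨ν, e₁.trans E, hν, fun i => by rw [RingEquiv.trans_apply, ht]⟩

/-- **`DeJong1996SplitNodalStructureSing` from `DeJong1996NodeLocalStructure` and the Remark of
2.23.** The isomorphism of `DeJong1996SplitNodalStructure.of_nodeLocalStructure` is `E ∘ e₁` with
`e₁` over `Â` and `E(u) = u`, `E(v) = v`; so once the Remark of 2.23 is known for the structure
isomorphisms `e₁ : 𝒪̂_{X,x} ≅ Â⟦u, v⟧/(uv - h)` over `Â` at the closed points of `Sing(f)` of the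
pair — "in this case (i.e. `h ∈ A'`) the trace of `Sing(f)` on the scheme `Spec B` is given by the
ideal `(u, v) ⊂ B`", i.e. `e₁` carries `Fitt₁(Ω_{X/Y})_x 𝒪̂_{X,x}` onto `(u, v)` (hypothesis
`hT`, to be supplied by the computation of the continuous differentials of `Â⟦u, v⟧/(uv - h)`;
it is NOT a named fact) — the composite carries `Fitt₁(Ω_{X/Y})_x 𝒪̂_{X,x}` onto
`E((u, v)) = (u, v)`. [cite: DeJong1996, 2.23 Remark, p. 62] -/
theorem DeJong1996SplitNodalStructureSing.of_nodeLocalStructure_of_singTrace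
    (hN : DeJong1996NodeLocalStructure.{u})
    (hT : ∀ (k : Type u) [Field k] [IsAlgClosed k] (X Y : Scheme.{u}) (f : X ⟶ Y)
      (g : Y ⟶ Spec (.of k)) (D : Set Y) (n : ℕ) (τ : Fin n → (Y ⟶ X)),
      DeJong1996.SemiStablePair f g D τ → ∀ (x : X), IsClosed ({x} : Set X) →
        (∀ U : X.Opens, x ∈ U → ¬ Smooth (U.ι ≫ f)) →
        ∀ (h : AdicCompletion (maximalIdeal (Y.presheaf.stalk (f x))) (Y.presheaf.stalk (f x)))
          (e : AdicCompletion (maximalIdeal (X.presheaf.stalk x)) (X.presheaf.stalk x) ≃+*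
            DeJong1996.NodeDeformationRing _ h),
          e.toRingHom.comp (DeJong1996.completedStalkMap f x) =
              DeJong1996.NodeDeformationRing.ofBase _ _ →
            ((Scheme.Hom.singFittingIdeal f x).map (algebraMap (X.presheaf.stalk x)
              (AdicCompletion (maximalIdeal (X.presheaf.stalk x)) (X.presheaf.stalk x)))).map
                e.toRingHom =
              Ideal.span {Ideal.Quotient.mk _ (MvPowerSeries.X 0),
                Ideal.Quotient.mk _ (MvPowerSeries.X 1)}) :
    DeJong1996SplitNodalStructureSing.{u} := by
  intro k _ _ X Y f g D n τ hS x hx hns m r t hspan hdim hrm hI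
  obtain ⟨ν, h, e₁, E, hν, he₁, ht, hE⟩ :=
    hS.exists_formalNodeRing_equiv_of_nodeLocalStructure hN hx hns t hspan hdim hrm hI
  have hF := hT k X Y f g D n τ hS x hx hns h e₁ he₁
  refine ⟨ν, e₁.trans E, hν, fun i => by rw [RingEquiv.trans_apply, ht], ?_⟩
  rw [RingEquiv.toRingHom_trans, ← Ideal.map_map, hF, Ideal.map_span, RingEquiv.toRingHom_eq_coe,
    RingHom.coe_coe, Set.image_pair, hE 0, hE 1]

end Literature.AlgebraicGeometry.Resolution

end
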